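import Mathlib
import Summits.Ventures.PercRepro2.PMK5Inactive
import Summits.Ventures.PercRepro2.PMK5LocusFace
import Summits.Ventures.PercRepro2.PMK5LocusZero
import Summits.Ventures.PercRepro2.PMK5LocusZeroA
import Summits.Ventures.PercRepro2.PMK5LocusI

/-!
# THE EQUALITY LOCUS OF THE `a₃`-INACTIVE VALUE OF (HCOV) ON FIVE-VERTEX BASES — THE ZERO SIDE AND THE «IFF»s
(blind cell PercRepro2, mine-2 g24; on `PMK5LocusI.lean` (the positive side), `PMK5LocusFace.lean` (restricted
tables, `kp`, `cnt3_restr_eq`, `eq_of_kron_eq`) and `PMK5LocusZeroA.lean` (`MxA`, `coverZA`: the `A`-degenerate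
edge sets form a down-set with the six maximal elements `249, 442, 503, 637, 926, 1011`))

The Kronecker numbers of the seven tables of the `a₃`-inactive form RESTRICTED to a face (`kPosIm`, `kNegIm`)
carry the class sums supported inside it digitwise (`kPosIm_eq`, `kNegIm_eq`, `cnt3_restr_eq`, `eq_of_kron_eq`),
and on each of the six maximal `A`-degenerate faces they are EQUAL (`faceI_*`, six `decide +kernel`): every
coefficient `CI(k′)` supported inside an `A`-degenerate face vanishes (`coefI_eq_of_face`), whence
**`i_K5_zero_of_face`** (the Bernstein form `Σ bern q k′ · 2 CI(k′)` vanishes on every `A`-degenerate face),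
**`gc_isolated_zero_of_face`** (`Gc p ends6 0 1 2 5 4 = 0` with the pendant edge closed), and the two «iff»s
**`gc_isolated_pos_iff`** / **`gc_isolated_zero_iff`**: with `a₃` isolated, (HCOV) on five-vertex bases is tight
EXACTLY at the `A`-degenerate placements (`RuleA`: the root pair separates `o` from `b`, or a root cannot reach `o`
avoiding the other root) and strict in the interior of every other face.  Standard axioms.
-/

namespace Summit.Ventures.PercRepro2

open Hub CovForm

namespace K5

namespace PM

/-! ## The restricted numbers and counts of the `a₃`-inactive form -/

/-- The positive part of the `a₃`-inactive form on the face `m` (`kPosI` with restricted tables). -/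
def kPosIm (m : ℕ) : ℕ :=
  kp (restr m tQ) (restr m tQBL) (restr m tQHo) + kp (restr m tQ) (restr m tQB) (restr m tQLo)
/-- The negative part of the `a₃`-inactive form on the face `m` (`kNegI` with restricted tables). -/
def kNegIm (m : ℕ) : ℕ :=
  kp (restr m tQ) (restr m tQ) (restr m tQBLo) + kp (restr m tQ) (restr m tQ) (restr m tQBLHo)
/-- The positive triple counts of the `a₃`-inactive form on the face `m`. -/
def cntPosIm (m : ℕ) (k : Fin 10 → Fin 4) : ℕ :=
  cnt3 (restr m tQ) (restr m tQBL) (restr m tQHo) k + cnt3 (restr m tQ) (restr m tQB) (restr m tQLo) k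
/-- The negative triple counts of the `a₃`-inactive form on the face `m`. -/
def cntNegIm (m : ℕ) (k : Fin 10 → Fin 4) : ℕ :=
  cnt3 (restr m tQ) (restr m tQ) (restr m tQBLo) k + cnt3 (restr m tQ) (restr m tQ) (restr m tQBLHo) k

/-- `kPosIm` carries the restricted positive counts. -/
lemma kPosIm_eq (m : ℕ) : kPosIm m = ∑ k, cntPosIm m k * KB ^ idx4 k := by
  unfold kPosIm cntPosIm
  simp only [kp_eq]
  rw [sum_add_mul5]
/-- `kNegIm` carries the restricted negative counts. -/
lemma kNegIm_eq (m : ℕ) : kNegIm m = ∑ k, cntNegIm m k * KB ^ idx4 k := by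
  unfold kNegIm cntNegIm
  simp only [kp_eq]
  rw [sum_add_mul5]
/-- The restricted positive counts are below `2^19` (two counts `≤ 3^10`). -/
lemma cntPosIm_lt (m : ℕ) (k : Fin 10 → Fin 4) : cntPosIm m k < 2 ^ 19 := by
  unfold cntPosIm
  have := cnt3_le (restr m tQ) (restr m tQBL) (restr m tQHo) k
  have := cnt3_le (restr m tQ) (restr m tQB) (restr m tQLo) k
  omega
/-- The restricted negative counts are below `2^19`. -/
lemma cntNegIm_lt (m : ℕ) (k : Fin 10 → Fin 4) : cntNegIm m k < 2 ^ 19 := by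
  unfold cntNegIm
  have := cnt3_le (restr m tQ) (restr m tQ) (restr m tQBLo) k
  have := cnt3_le (restr m tQ) (restr m tQ) (restr m tQBLHo) k
  omega

/-! ## The six maximal `A`-degenerate faces (kernel) -/

set_option maxRecDepth 100000 in
/-- The restricted numbers of the `a₃`-inactive form agree on the face `249` = {oa1 ob a1a2 a1u a1b a2u}. -/
theorem faceI_249 : kPosIm 249 = kNegIm 249 := by
  decide +kernel

set_option maxRecDepth 100000 in
/-- The restricted numbers of the `a₃`-inactive form agree on the face `442` = {oa2 ob a1a2 a1u a2u a2b}. -/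
theorem faceI_442 : kPosIm 442 = kNegIm 442 := by
  decide +kernel

set_option maxRecDepth 100000 in
/-- The restricted numbers of the `a₃`-inactive form agree on the face `503` = {oa1 oa2 ou a1a2 a1u a1b a2u a2b}. -/
theorem faceI_503 : kPosIm 503 = kNegIm 503 := by
  decide +kernel

set_option maxRecDepth 100000 in
/-- The restricted numbers of the `a₃`-inactive form agree on the face `637` = {oa1 ou ob a1a2 a1u a1b ub}. -/
theorem faceI_637 : kPosIm 637 = kNegIm 637 := by
  decide +kernel

set_option maxRecDepth 100000 in
/-- The restricted numbers of the `a₃`-inactive form agree on the face `926` = {oa2 ou ob a1a2 a2u a2b ub}. -/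
theorem faceI_926 : kPosIm 926 = kNegIm 926 := by
  decide +kernel

set_option maxRecDepth 100000 in
/-- The restricted numbers of the `a₃`-inactive form agree on the face `1011` = {oa1 oa2 a1a2 a1u a1b a2u a2b ub}. -/
theorem faceI_1011 : kPosIm 1011 = kNegIm 1011 := by
  decide +kernel

/-- **Every coefficient of the `a₃`-inactive form supported inside a face with equal restricted numbers vanishes.** -/
theorem coefI_eq_of_face (m : ℕ) (hz : kPosIm m = kNegIm m) (k : Fin 10 → Fin 4)
    (hk : ∀ e : Fin 10, k e ≠ 0 → m.testBit e = true) : cntPosI k = cntNegI k := by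
  have h := eq_of_kron_eq _ _ (cntPosIm_lt m) (cntNegIm_lt m) (kPosIm_eq m) (kNegIm_eq m) hz k
  unfold cntPosIm cntNegIm at h
  simp only [cnt3_restr_eq hk] at h
  unfold cntPosI cntNegI
  omega

/-- The restricted numbers agree on each maximal `A`-degenerate face. -/
theorem faceI_all : ∀ i : Fin 6, kPosIm (MxA i) = kNegIm (MxA i) := by
  intro i
  fin_cases i
  exacts [faceI_249, faceI_442, faceI_503, faceI_637, faceI_926, faceI_1011]

section Face

variable {R : Type*} [Field R] [LinearOrder R] [IsStrictOrderedRing R]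

omit [LinearOrder R] [IsStrictOrderedRing R] in
/-- **THE EQUALITY LOCUS OF THE `a₃`-INACTIVE VALUE — THE ZERO SIDE (Bernstein form)**: on every `A`-degenerate
edge set `m`, `Σ_k′ bern q k′ · 2 CI(k′) = 0` at every weight vector `q` supported on `m`. -/
theorem i_K5_zero_of_face (m : ℕ) (hm : m < 1024) (hr : RuleA m = true) (q : Fin 10 → R)
    (hq₀ : ∀ e : Fin 10, m.testBit e = false → q e = 0) :
    ∑ k' : Fin 10 → Fin 4, bern q k' * (2 * Pendant.CI k') = 0 := by
  refine Finset.sum_eq_zero fun k _ => ?_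
  by_cases hk : ∀ e : Fin 10, k e ≠ 0 → m.testBit e = true
  · obtain ⟨i, hi⟩ := coverZA ⟨m, hm⟩ hr
    have hc := coefI_eq_of_face (MxA i) (faceI_all i) k fun e he => hi e (hk e he)
    unfold Pendant.CI
    rw [hc, sub_self, mul_zero, mul_zero]
  · obtain ⟨e, he⟩ := not_forall.1 hk
    obtain ⟨hke, hme⟩ := Classical.not_imp.1 he
    have hqe : q e = 0 := hq₀ e (by simpa using hme)
    have hb : bern q k = 0 := by
      unfold bern
      apply Finset.prod_eq_zero (Finset.mem_univ e)
      rw [hqe, zero_pow (fun h => hke (Fin.ext (by simpa using h)))]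
      simp
    rw [hb, zero_mul]

/-- **THE `a₃`-ISOLATED CRUX FUNCTIONAL VANISHES ON EVERY `A`-DEGENERATE FACE**: for `p` on `K5.Pendant.ends6`
with the pendant edge closed and `p` supported on the `K₅` edge set `m`, `Gc p ends6 0 1 2 5 4 = 0` whenever
`m` is `A`-degenerate. -/
theorem gc_isolated_zero_of_face (m : ℕ) (hm : m < 1024) (hr : RuleA m = true) (p : Fin 11 → R)
    (hp₀ : ∀ e : Fin 10, m.testBit e = false → p (Fin.castSucc e) = 0)
    (hpl : p (Fin.last 10) = 0) : Gc p Pendant.ends6 0 1 2 5 4 = 0 := by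
  have hup : Function.update p (Fin.last 10) 0 = p := by
    rw [← hpl]; exact Function.update_eq_self _ _
  rw [← hup, Pendant.Gc_zero_eq_bern_I]
  exact i_K5_zero_of_face m hm hr (p ∘ Fin.castSucc) hp₀

/-- The centre of the face `m` with the pendant edge closed. -/
noncomputable def centreI (m : ℕ) : Fin 11 → R := Fin.snoc (α := fun _ => R) (centre m) 0

omit [LinearOrder R] [IsStrictOrderedRing R] in
/-- `centreI` restricted to the `K₅` edges is the centre of `m`. -/
lemma centreI_castSucc (m : ℕ) (e : Fin 10) : centreI (R := R) m (Fin.castSucc e) = centre m e := by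
  unfold centreI; simp [Fin.snoc_castSucc]

omit [LinearOrder R] [IsStrictOrderedRing R] in
/-- The pendant weight of `centreI` is `0`. -/
lemma centreI_last (m : ℕ) : centreI (R := R) m (Fin.last 10) = 0 :=
  Fin.snoc_last _ _

/-- **THE EQUALITY LOCUS OF (HCOV) WITH `a₃` ISOLATED, FIRST «IFF»**: `Gc > 0` at every weight vector interior on
`m` with the pendant edge closed ⟺ `m` is not `A`-degenerate. -/
theorem gc_isolated_pos_iff (m : ℕ) (hm : m < 1024) :
    (∀ p : Fin 11 → R, (∀ e : Fin 10, m.testBit e = true → 0 < p (Fin.castSucc e) ∧ p (Fin.castSucc e) < 1) →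
      (∀ e : Fin 10, m.testBit e = false → p (Fin.castSucc e) = 0) → p (Fin.last 10) = 0 →
      0 < Gc p Pendant.ends6 0 1 2 5 4) ↔ RuleA m = false := by
  constructor
  · intro h
    rcases Bool.eq_false_or_eq_true (RuleA m) with hr | hr
    · exfalso
      have hpos := h (centreI (R := R) m) (fun e he => by rw [centreI_castSucc]; exact centre_on_pos he)
        (fun e he => by rw [centreI_castSucc]; exact centre_off he) (centreI_last m)
      have hzero := gc_isolated_zero_of_face m hm hr (centreI (R := R) m)
        (fun e he => by rw [centreI_castSucc]; exact centre_off he) (centreI_last m)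
      rw [hzero] at hpos
      exact lt_irrefl _ hpos
    · exact hr
  · intro hr p hp₁ hp₀ hpl
    exact gc_isolated_pos_of_face m hm hr p hp₁ hp₀ hpl

/-- **THE EQUALITY LOCUS OF (HCOV) WITH `a₃` ISOLATED, SECOND «IFF»**: `Gc = 0` at every admissible weight vector
supported on `m` with the pendant edge closed ⟺ `m` is `A`-degenerate. -/
theorem gc_isolated_zero_iff (m : ℕ) (hm : m < 1024) :
    (∀ p : Fin 11 → R, (∀ e : Fin 11, 0 ≤ p e ∧ p e ≤ 1) →
      (∀ e : Fin 10, m.testBit e = false → p (Fin.castSucc e) = 0) → p (Fin.last 10) = 0 →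
      Gc p Pendant.ends6 0 1 2 5 4 = 0) ↔ RuleA m = true := by
  constructor
  · intro h
    rcases Bool.eq_false_or_eq_true (RuleA m) with hr | hr
    · exact hr
    · exfalso
      have hpos := gc_isolated_pos_of_face m hm hr (centreI (R := R) m)
        (fun e he => by rw [centreI_castSucc]; exact centre_on_pos he)
        (fun e he => by rw [centreI_castSucc]; exact centre_off he) (centreI_last m)
      have h01 : ∀ e : Fin 11, 0 ≤ centreI (R := R) m e ∧ centreI (R := R) m e ≤ 1 := by
        intro e
        induction e using Fin.lastCases with
        | last => rw [centreI_last]; exact ⟨le_rfl, zero_le_one⟩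
        | cast e => rw [centreI_castSucc]; exact centre_01 m e
      have hzero := h (centreI (R := R) m) h01 (fun e he => by rw [centreI_castSucc]; exact centre_off he)
        (centreI_last m)
      rw [hzero] at hpos
      exact lt_irrefl _ hpos
  · intro hr p _ hp₀ hpl
    exact gc_isolated_zero_of_face m hm hr p hp₀ hpl

end Face

end PM

end K5

end Summit.Ventures.PercRepro2
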